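import Mathlib
import Literature.NumberTheory.Irrationality.Zudilin2002.WellPoisedIntegrals
import HarnessLib

/-!
# ζ(5) search — Families: the integral-side involution `σ` of the 5-fold Beukers–Vasilyev–Sorokin integrals `J₅`

HONEST FRAMING: systematic search; no irrationality claim unless certified.

Cell `pub-zeta5`, seat P2, for `fam-sorokin` (families/sorokin/FAMILY.md §2c, §5(β): "σ-invariance is a clean, elementary,
PUBLISHED statement about the TREE object `sorokinIntegral 5` … candidate … PROVED tree lemma").  The statement is
S. Fischler, *Groupes de Rhin–Viola et intégrales multiples*, J. Théor. Nombres Bordeaux 15 (2003) 479–534, Proposition 10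
(p. 509: "σ échange a₁ et b₂, ainsi que a₂ et b₁ …", proof = the change of variables below), in the normalisation of the
tree's `Zudilin2002.sorokinIntegral` [Zudilin2002VWPIntegrals, eq. (2)–(3)]
`J₅(a₀; a₁,…,a₅ | b₁,…,b₅) = ∫_{[0,1]⁵} ∏ x_j^{a_j−1}(1−x_j)^{b_j−a_j−1} / Q₅(x)^{a₀}`,
`Q₅ = 1 − x₁(1 − x₂(1 − x₃(1 − x₄(1 − x₅))))`:

  the change of variables `(x₄, x₅) ↦ (1 − x₅, 1 − x₄)` fixes `Q₅` (it enters only through `1 − x₄ + x₄x₅`) and maps the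
  integrand of `(a₀; a | b)` to that of `σ(a₀; a | b) := (a₀; a₁, a₂, a₃, b₅ − a₅, b₄ − a₄ | b₁, b₂, b₃, b₅, b₄)`,

hence `J₅(σ p) = J₅(p)`.  PROVED here for ALL real parameters and unconditionally (`sorokinIntegral_sigma`): the map is a
measure-preserving involution of the cube (`measurePreserving_sigmaMap`, via `volume_measurePreserving_piCongrLeft` and
`Measure.measurePreserving_sub_left`), the integrands agree pointwise on all of `ℝ⁵` (`sorokinIntegrand_sigma`), and the
change-of-variables formula for measurable embeddings needs no integrability — so both sides are also equal when they are
Mathlib's junk value.  Parameters are read 0-based as in the tree (`a 3 = a₄`, `a 4 = a₅`, …).  This is OUR proof of a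
published statement about a Literature object; the lit seat may re-home it under `Literature/` with the JTNB citation.
-/

noncomputable section

open MeasureTheory Set

namespace Summit.KontsevichZagierPeriods.Zeta5Search.Families.Sorokin

open Literature.NumberTheory.Irrationality.Zudilin2002

/-- The involution `(x₄, x₅) ↦ (1 − x₅, 1 − x₄)` of `ℝ⁵` (0-based coordinates `3, 4`). -/
def sigmaMap (x : Fin 5 → ℝ) : Fin 5 → ℝ :=
  fun i => if i = 3 then 1 - x 4 else if i = 4 then 1 - x 3 else x i

/-- `σ` on the numerator parameters: `(a₁,…,a₅) ↦ (a₁, a₂, a₃, b₅ − a₅, b₄ − a₄)` (0-based indices `3, 4`). -/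
def sigmaA (a b : ℕ → ℝ) : ℕ → ℝ :=
  fun j => if j = 3 then b 4 - a 4 else if j = 4 then b 3 - a 3 else a j

/-- `σ` on the second parameter row: `(b₁,…,b₅) ↦ (b₁, b₂, b₃, b₅, b₄)`. -/
def sigmaB (b : ℕ → ℝ) : ℕ → ℝ :=
  fun j => if j = 3 then b 4 else if j = 4 then b 3 else b j

/-- `sigmaMap` is an involution. -/
theorem sigmaMap_sigmaMap (x : Fin 5 → ℝ) : sigmaMap (sigmaMap x) = x := by
  ext i
  fin_cases i <;> simp [sigmaMap]

/-- `σ` is an involution on parameters. -/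
theorem sigma_sigma (a b : ℕ → ℝ) : sigmaA (sigmaA a b) (sigmaB b) = a ∧ sigmaB (sigmaB b) = b := by
  constructor
  · ext j
    by_cases h3 : j = 3
    · subst h3; simp [sigmaA, sigmaB]
    · by_cases h4 : j = 4
      · subst h4; simp [sigmaA, sigmaB]
      · simp [sigmaA, h3, h4]
  · ext j
    by_cases h3 : j = 3
    · subst h3; simp [sigmaB]
    · by_cases h4 : j = 4
      · subst h4; simp [sigmaB]
      · simp [sigmaB, h3, h4]

/-- `sigmaMap` is measurable. -/
theorem measurable_sigmaMap : Measurable sigmaMap := by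
  refine measurable_pi_lambda _ fun i => ?_
  by_cases h3 : i = 3
  · simp only [sigmaMap, h3, if_true]
    exact measurable_const.sub (measurable_pi_apply 4)
  · by_cases h4 : i = 4
    · simp only [sigmaMap, h4, if_true]
      exact measurable_const.sub (measurable_pi_apply 3)
    · simp only [sigmaMap, h3, h4, if_false]
      exact measurable_pi_apply i

/-- `sigmaMap` as a measurable equivalence of `ℝ⁵`. -/
def sigmaEquiv : (Fin 5 → ℝ) ≃ᵐ (Fin 5 → ℝ) where
  toFun := sigmaMap
  invFun := sigmaMap
  left_inv := sigmaMap_sigmaMap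
  right_inv := sigmaMap_sigmaMap
  measurable_toFun := measurable_sigmaMap
  measurable_invFun := measurable_sigmaMap

/-- `sigmaMap` preserves Lebesgue measure on `ℝ⁵` (swap of two coordinates followed by two reflections `t ↦ 1 − t`). -/
theorem measurePreserving_sigmaMap : MeasurePreserving sigmaMap volume volume := by
  set s : Fin 5 ≃ Fin 5 := Equiv.swap 3 4 with hs
  have hS := volume_measurePreserving_piCongrLeft (fun _ : Fin 5 => ℝ) s
  have hT : ∀ (w : Fin 5 → ℝ) (k : Fin 5), MeasurableEquiv.piCongrLeft (fun _ : Fin 5 => ℝ) s w k = w (s k) := by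
    intro w k
    have := MeasurableEquiv.piCongrLeft_apply_apply (β := fun _ : Fin 5 => ℝ) s w (s k)
    have hss : s (s k) = k := by simp [hs, Equiv.swap_apply_self]
    rw [hss] at this
    exact this
  have hf : ∀ i : Fin 5, MeasurePreserving
      (fun t : ℝ => if i = 3 ∨ i = 4 then 1 - t else t) volume volume := by
    intro i
    by_cases h : i = 3 ∨ i = 4
    · simp only [h, if_true]
      exact Measure.measurePreserving_sub_left volume 1
    · simp only [h, if_false]
      exact MeasurePreserving.id volume
  have hP := volume_preserving_pi hf
  have hfun : sigmaMap = (fun (x : Fin 5 → ℝ) (i : Fin 5) => if i = 3 ∨ i = 4 then 1 - x i else x i) ∘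
      (MeasurableEquiv.piCongrLeft (fun _ : Fin 5 => ℝ) s) := by
    funext x
    funext i
    simp only [Function.comp_apply, hT]
    fin_cases i <;> simp [sigmaMap, hs, Equiv.swap_apply_of_ne_of_ne]
  rw [hfun]
  exact hP.comp hS

/-- `sigmaMap` on the coordinates. -/
theorem sigmaMap_apply (x : Fin 5 → ℝ) :
    sigmaMap x 3 = 1 - x 4 ∧ sigmaMap x 4 = 1 - x 3 ∧ ∀ i, i ≠ 3 → i ≠ 4 → sigmaMap x i = x i := by
  refine ⟨by simp [sigmaMap], by simp [sigmaMap], fun i h3 h4 => by simp [sigmaMap, h3, h4]⟩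

/-- The cube `[0,1]⁵` is invariant under `sigmaMap`. -/
theorem sigmaMap_preimage_cube :
    sigmaMap ⁻¹' (Set.pi Set.univ fun _ : Fin 5 => Icc (0 : ℝ) 1) = Set.pi Set.univ fun _ => Icc (0 : ℝ) 1 := by
  ext x
  simp only [mem_preimage, mem_univ_pi, mem_Icc]
  obtain ⟨e3, e4, eo⟩ := sigmaMap_apply x
  constructor
  · intro h i
    by_cases h3 : i = 3
    · subst h3; have := h 4; rw [e4] at this; constructor <;> linarith [this.1, this.2]
    · by_cases h4 : i = 4
      · subst h4; have := h 3; rw [e3] at this; constructor <;> linarith [this.1, this.2]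
      · have := h i; rwa [eo i h3 h4] at this
  · intro h i
    by_cases h3 : i = 3
    · subst h3; have := h 4; rw [e3]; constructor <;> linarith [this.1, this.2]
    · by_cases h4 : i = 4
      · subst h4; have := h 3; rw [e4]; constructor <;> linarith [this.1, this.2]
      · rw [eo i h3 h4]; exact h i

/-- The kernel `Q₅` is `sigmaMap`-invariant and the numerator factors are exchanged with the `σ`-parameters: the
integrand of `σ(a₀; a | b)` at `sigmaMap x` is the integrand of `(a₀; a | b)` at `x`, for every `x ∈ ℝ⁵`.
[Fischler JTNB 2003, proof of Prop. 10] -/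
theorem sorokinIntegrand_sigma (a₀ : ℝ) (a b : ℕ → ℝ) (x : Fin 5 → ℝ) :
    sorokinIntegrand 5 a₀ (sigmaA a b) (sigmaB b) (sigmaMap x) = sorokinIntegrand 5 a₀ a b x := by
  simp [sorokinIntegrand, Fin.prod_univ_five, List.ofFn_succ, nestedQ, sigmaMap, sigmaA, sigmaB]
  ring

/-- **σ-invariance of `J₅`** [Fischler JTNB 2003, Prop. 10; fam-sorokin FAMILY.md §2c]:
`J₅(a₀; a₁,a₂,a₃, b₅−a₅, b₄−a₄ | b₁,b₂,b₃, b₅, b₄) = J₅(a₀; a₁,…,a₅ | b₁,…,b₅)` for all real parameters (no convergence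
hypothesis: both sides are the same Bochner integral after a measure-preserving involution of the cube). -/
theorem sorokinIntegral_sigma (a₀ : ℝ) (a b : ℕ → ℝ) :
    sorokinIntegral 5 a₀ (sigmaA a b) (sigmaB b) = sorokinIntegral 5 a₀ a b := by
  unfold sorokinIntegral
  have hemb : MeasurableEmbedding sigmaMap := sigmaEquiv.measurableEmbedding
  have key := measurePreserving_sigmaMap.setIntegral_preimage_emb hemb
    (sorokinIntegrand 5 a₀ (sigmaA a b) (sigmaB b)) (Set.pi Set.univ fun _ : Fin 5 => Icc (0 : ℝ) 1)
  rw [sigmaMap_preimage_cube] at key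
  rw [← key]
  congr 1
  ext x
  exact sorokinIntegrand_sigma a₀ a b x

end Summit.KontsevichZagierPeriods.Zeta5Search.Families.Sorokin
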